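import Mathlib
import Literature.Analysis.FluidPDE.VectorCalculus

/-!
# Rosenhead kernel: cubic-moment and local-induction remainder bounds

Tools stub `stub_rosenheadMomentBounds` of line `Sketch` (crux `SkeletonEquilibrium`, thesis
`FilamentSkeletonRss`). With `K_e(s) = (s² + e²)^{-3/2}` the Rosenhead-regularised
Biot–Savart kernel with core `e > 0` and
`L_e(δ) := arsinh(δ/e) − δ/√(δ²+e²) = ½ ∫_{−δ}^{δ} s² K_e(s) ds` the local-induction (LIA)
coefficient of a vortex filament on the window `|s| ≤ δ`, we prove the three remainder
controls used by the core proofs of the line: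

1. `|s|³ K_e(s) ≤ 1` pointwise, uniformly in `e`;
2. hence `∫_{−δ}^{δ} |s|³ K_e(s) ds ≤ 2δ` for `δ ≥ 0`;
3. for `0 < e ≤ δ`, `log(2δ/e) − 1 ≤ L_e(δ) ≤ log(2δ/e) − 1 + e²/δ²`.

All three are elementary real inequalities (Mathlib only): (1) is `|s| ≤ √(s²+e²)` cubed;
(2) is (1) integrated over a window of length `2δ`; (3) puts `x = δ/e ≥ 1` and uses
`2x ≤ x + √(1+x²) ≤ 2x (1 + 1/(4x²))`, `log y ≤ y − 1`, and
`1 − e²/(2δ²) ≤ δ/√(δ²+e²) ≤ 1`.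
-/

noncomputable section

open MeasureTheory Filter Topology
open Literature.Analysis.FluidPDE

namespace Summit.NavierStokesRegularity.NavierStokesRegularity.Theorems.SkeletonEquilibrium.Sketch
set_option linter.dupNamespace false

/-- `(s² + e²)^{3/2} = √(s² + e²)³`. [folklore] -/
private theorem rmb_rpow_three_halves_eq (e s : ℝ) :
    (s ^ 2 + e ^ 2) ^ (3 / 2 : ℝ) = Real.sqrt (s ^ 2 + e ^ 2) ^ 3 := by
  rw [Real.rpow_div_two_eq_sqrt 3 (by positivity), Real.rpow_ofNat]

/-- Part 1: the cubic moment against the Rosenhead kernel is at most `1` pointwise,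
uniformly in the core `e > 0`: `|s|³ (s² + e²)^{-3/2} ≤ 1`. [folklore] -/
private theorem rmb_pointwise (e s : ℝ) (he : 0 < e) :
    |s| ^ 3 * ((s ^ 2 + e ^ 2) ^ (3 / 2 : ℝ))⁻¹ ≤ 1 := by
  have hpos : 0 < (s ^ 2 + e ^ 2) ^ (3 / 2 : ℝ) := Real.rpow_pos_of_pos (by positivity) _
  rw [← div_eq_mul_inv, div_le_one hpos, rmb_rpow_three_halves_eq]
  have hsqrt : |s| ≤ Real.sqrt (s ^ 2 + e ^ 2) :=
    Real.abs_le_sqrt (le_add_of_nonneg_right (sq_nonneg e))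
  exact pow_le_pow_left₀ (abs_nonneg s) hsqrt 3

/-- Part 2: the window integral of the cubic moment is at most the window length,
`∫_{−δ}^{δ} |s|³ (s² + e²)^{-3/2} ds ≤ 2δ` for `δ ≥ 0`. [folklore] -/
private theorem rmb_window (e δ : ℝ) (he : 0 < e) (hδ : 0 ≤ δ) :
    ∫ s in (-δ)..δ, |s| ^ 3 * ((s ^ 2 + e ^ 2) ^ (3 / 2 : ℝ))⁻¹ ≤ 2 * δ := by
  have h := intervalIntegral.norm_integral_le_of_norm_le_const (a := -δ) (b := δ) (C := 1)
    (f := fun s : ℝ => |s| ^ 3 * ((s ^ 2 + e ^ 2) ^ (3 / 2 : ℝ))⁻¹) (fun x _ => by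
      rw [Real.norm_eq_abs, abs_of_nonneg (by positivity)]
      exact rmb_pointwise e x he)
  calc ∫ s in (-δ)..δ, |s| ^ 3 * ((s ^ 2 + e ^ 2) ^ (3 / 2 : ℝ))⁻¹
      ≤ ‖∫ s in (-δ)..δ, |s| ^ 3 * ((s ^ 2 + e ^ 2) ^ (3 / 2 : ℝ))⁻¹‖ := Real.le_norm_self _
    _ ≤ 1 * |δ - -δ| := h
    _ = 2 * δ := by
        rw [sub_neg_eq_add, abs_of_nonneg (by linarith)]
        ring

/-- `log (2x) ≤ arsinh x` for `x > 0`, from `2x ≤ x + √(1 + x²)`. [folklore] -/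
private theorem rmb_log_two_mul_le_arsinh {x : ℝ} (hx : 0 < x) :
    Real.log (2 * x) ≤ Real.arsinh x := by
  have hs : x ≤ Real.sqrt (1 + x ^ 2) :=
    Real.le_sqrt_of_sq_le (le_add_of_nonneg_left zero_le_one)
  have h2 : 2 * x ≤ x + Real.sqrt (1 + x ^ 2) := by linarith
  unfold Real.arsinh
  exact Real.log_le_log (by positivity) h2

/-- `arsinh x ≤ log (2x) + 1/(4x²)` for `x > 0`, from `√(1 + x²) ≤ x + 1/(2x)` and
`log y ≤ y − 1`. [folklore] -/
private theorem rmb_arsinh_le {x : ℝ} (hx : 0 < x) :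
    Real.arsinh x ≤ Real.log (2 * x) + 1 / (4 * x ^ 2) := by
  have hx2 : 0 < 2 * x := by positivity
  have hq : 0 < 1 + 1 / (4 * x ^ 2) := by positivity
  have hs : Real.sqrt (1 + x ^ 2) ≤ x + 1 / (2 * x) := by
    rw [Real.sqrt_le_left (by positivity)]
    have hkey : (x + 1 / (2 * x)) ^ 2 = 1 + x ^ 2 + 1 / (4 * x ^ 2) := by
      field_simp
      ring
    rw [hkey]
    have : 0 ≤ 1 / (4 * x ^ 2) := by positivity
    linarith
  have hsum : x + Real.sqrt (1 + x ^ 2) ≤ 2 * x * (1 + 1 / (4 * x ^ 2)) := by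
    have : 2 * x * (1 + 1 / (4 * x ^ 2)) = x + (x + 1 / (2 * x)) := by
      field_simp
      ring
    rw [this]
    linarith
  have hpos : 0 < x + Real.sqrt (1 + x ^ 2) := by positivity
  unfold Real.arsinh
  calc Real.log (x + Real.sqrt (1 + x ^ 2))
      ≤ Real.log (2 * x * (1 + 1 / (4 * x ^ 2))) := Real.log_le_log hpos hsum
    _ = Real.log (2 * x) + Real.log (1 + 1 / (4 * x ^ 2)) := Real.log_mul hx2.ne' hq.ne'
    _ ≤ Real.log (2 * x) + 1 / (4 * x ^ 2) := by
        have := Real.log_le_sub_one_of_pos hq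
        linarith

/-- `δ/√(δ² + e²) ≤ 1` for `e > 0`. [folklore] -/
private theorem rmb_div_sqrt_le_one {e : ℝ} (δ : ℝ) (he : 0 < e) :
    δ / Real.sqrt (δ ^ 2 + e ^ 2) ≤ 1 := by
  have hR : 0 < Real.sqrt (δ ^ 2 + e ^ 2) := Real.sqrt_pos.mpr (by positivity)
  rw [div_le_one hR]
  exact Real.le_sqrt_of_sq_le (le_add_of_nonneg_right (sq_nonneg e))

/-- `1 − e²/(2δ²) ≤ δ/√(δ² + e²)` for `0 < e ≤ δ`: with `R = √(δ² + e²)` this is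
`(2δ² − e²) R ≤ 2δ³`, i.e. `(R − δ)² (R + 2δ) ≥ 0` after `R² = δ² + e²`. [folklore] -/
private theorem rmb_one_sub_le_div_sqrt {e δ : ℝ} (he : 0 < e) (hδ : e ≤ δ) :
    1 - e ^ 2 / (2 * δ ^ 2) ≤ δ / Real.sqrt (δ ^ 2 + e ^ 2) := by
  have hδpos : 0 < δ := lt_of_lt_of_le he hδ
  have hRpos : 0 < Real.sqrt (δ ^ 2 + e ^ 2) := Real.sqrt_pos.mpr (by positivity)
  have hR2 : Real.sqrt (δ ^ 2 + e ^ 2) ^ 2 = δ ^ 2 + e ^ 2 := Real.sq_sqrt (by positivity)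
  generalize Real.sqrt (δ ^ 2 + e ^ 2) = R at hRpos hR2 ⊢
  have hδ2 : 0 < 2 * δ ^ 2 := by positivity
  have hexp : 1 - e ^ 2 / (2 * δ ^ 2) = (2 * δ ^ 2 - e ^ 2) / (2 * δ ^ 2) := by
    rw [sub_div, div_self hδ2.ne']
  rw [le_div_iff₀ hRpos, hexp, div_mul_eq_mul_div, div_le_iff₀ hδ2]
  have h3 : R ^ 3 = (δ ^ 2 + e ^ 2) * R := by
    rw [← hR2]
    ring
  nlinarith [mul_nonneg (sq_nonneg (R - δ)) (by positivity : (0 : ℝ) ≤ R + 2 * δ), h3]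

/-- Part 3: two-sided asymptotics of the LIA coefficient,
`log(2δ/e) − 1 ≤ arsinh(δ/e) − δ/√(δ²+e²) ≤ log(2δ/e) − 1 + e²/δ²` for `0 < e ≤ δ`.
[folklore] -/
private theorem rmb_lia (e δ : ℝ) (he : 0 < e) (hδ : e ≤ δ) :
    Real.log (2 * δ / e) - 1 ≤ Real.arsinh (δ / e) - δ / Real.sqrt (δ ^ 2 + e ^ 2) ∧
      Real.arsinh (δ / e) - δ / Real.sqrt (δ ^ 2 + e ^ 2) ≤
        Real.log (2 * δ / e) - 1 + e ^ 2 / δ ^ 2 := by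
  have hδpos : 0 < δ := lt_of_lt_of_le he hδ
  have hx : 0 < δ / e := div_pos hδpos he
  have hlog : Real.log (2 * δ / e) = Real.log (2 * (δ / e)) := by
    rw [mul_div_assoc]
  have hlow := rmb_log_two_mul_le_arsinh hx
  have hup := rmb_arsinh_le hx
  have hconv : 1 / (4 * (δ / e) ^ 2) = e ^ 2 / δ ^ 2 / 4 := by
    field_simp
  have hq1 : δ / Real.sqrt (δ ^ 2 + e ^ 2) ≤ 1 := rmb_div_sqrt_le_one δ he
  have hq2 := rmb_one_sub_le_div_sqrt he hδ
  have hq3 : e ^ 2 / (2 * δ ^ 2) = e ^ 2 / δ ^ 2 / 2 := by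
    rw [div_div, mul_comm]
  have hε : 0 ≤ e ^ 2 / δ ^ 2 := by positivity
  rw [hconv] at hup
  rw [hq3] at hq2
  rw [hlog]
  constructor <;> linarith

/-- **Tools stub** (`stub_rosenheadMomentBounds`): remainder controls for the
Rosenhead-regularised Biot–Savart kernel `K_e(s) = (s² + e²)^{-3/2}` with core `e > 0`:
(1) the cubic moment is bounded pointwise, `|s|³ K_e(s) ≤ 1`, uniformly in `e`;
(2) hence its window integral satisfies `∫_{−δ}^{δ} |s|³ K_e ≤ 2δ` for `δ ≥ 0`;
(3) the local-induction coefficient `L_e(δ) = arsinh(δ/e) − δ/√(δ²+e²)` satisfies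
`log(2δ/e) − 1 ≤ L_e(δ) ≤ log(2δ/e) − 1 + e²/δ²` for `0 < e ≤ δ`. [folklore] -/
theorem stub_rosenheadMomentBounds :
    (∀ e s : ℝ, 0 < e → |s| ^ 3 * ((s ^ 2 + e ^ 2) ^ (3 / 2 : ℝ))⁻¹ ≤ 1) ∧
    (∀ e δ : ℝ, 0 < e → 0 ≤ δ →
      ∫ s in (-δ)..δ, |s| ^ 3 * ((s ^ 2 + e ^ 2) ^ (3 / 2 : ℝ))⁻¹ ≤ 2 * δ) ∧
    (∀ e δ : ℝ, 0 < e → e ≤ δ →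
      Real.log (2 * δ / e) - 1 ≤ Real.arsinh (δ / e) - δ / Real.sqrt (δ ^ 2 + e ^ 2) ∧
      Real.arsinh (δ / e) - δ / Real.sqrt (δ ^ 2 + e ^ 2) ≤ Real.log (2 * δ / e) - 1 + e ^ 2 / δ ^ 2) :=
  ⟨rmb_pointwise, rmb_window, rmb_lia⟩

end Summit.NavierStokesRegularity.NavierStokesRegularity.Theorems.SkeletonEquilibrium.Sketch
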